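import Mathlib
import Summits.NavierStokesRegularity.NavierStokesRegularity.Theorems.SubOnsagerCeilingKPSideBranchClassDynamics
import Summits.NavierStokesRegularity.NavierStokesRegularity.Theorems.SubOnsagerCeilingKPFluxBudget
import HarnessLib

/-!
# ENERGY STARVATION of the RE-ENTRY PAIR (asymmetric 2-cycle) by dead-end pump exits — mechanism file
# (helper file for the crux `SubOnsagerCeiling.ForwardTailCeilingKP`, stmt-NavierStokesRegularity-27057, `--supports`; part 1 of 2)

THE PAIR-EXIT CLASS (def-free, by coefficient hypotheses on a KP network proper `α ∈ E₂(R)`: symmetric, cancelling, orthant,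
diagonal feeds): the re-entry pair `0 ⇄ 1` — `x²_{0,k} → x_{1,k+1}` with weight `c 0 > 0` and `x²_{1,k} → x_{0,k+1}` with weight
`c 1 > 0` (ASYMMETRIC weights allowed; `kpTwoCycleTable c₀ c₁` is the model) — each live mode pumping in-shell into its own DEAD-END
pocket, `x²_{0,k} → x_{2,k}` (weight `P 0 ≥ 0`) and `x²_{1,k} → x_{3,k}` (weight `P 1 ≥ 0`); nothing else.  Landed so far for the pair:
the uniform pair at `b ∈ [1.34, 2]` (RUNG 8) and the asymmetric pair inside a companion-weight window (leafhand-1); here the pair with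
STRONG exits (`P a² > ε₀·c a²` for `a = 0, 1`) at EVERY scale ratio, by the shell-summed form of energy starvation:

* `pairExit_coeff`, `pairExit_inShell`, `pairExit_quadTerm_zero/_one/_two/_three`, `pairExit_gateFlux` — closed forms;
* `pairExit_pocket_ge_zero/_one` — `x_{2,N} ≥ (P 0/c 0)·x_{1,N+1}` and `x_{3,N} ≥ (P 1/c 1)·x_{0,N+1}` on `[0,s]`, `N ≥ 1`;
* `pairExit_flux_step`, `pairExit_flux_le` — the GATE fluxes `G_{m}(t) = ∫₀ᵗ Λ_m (c₀x²_{0,m}x_{1,m+1} + c₁x²_{1,m}x_{0,m+1})` starve: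
  `(1 + r)·G_{m+1} ≤ G_m`, `r = min (P 0²/c 0²) (P 1²/c 1²)`, `G_m ≤ E₀ q^m` (live-pair energy balance per shell: in-gate = stored +
  out-gate + pump work + dissipation, pump work `≥ r ×` out-gate).

The sequel `Theorems/SubOnsagerCeilingKPPairExitBarrier.lean`: `ShellBarrierAt R ε₀ α` with `(1+ε₀)^{2θ} = 1 + r`, `D = 1 + r`,
at EVERY scale ratio (`θ > 1/2` iff `r > ε₀`).
HONEST FRAMING: statements about Tao-type MODEL lattice ODEs (route SubOnsagerCeiling, rung TL-M2Break); one architecture class;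
no stub, crux or summit is proved and nothing here bears on Navier–Stokes regularity.
[cite: Tao2016AveragedNS, §4 (4.2)–(4.3), (4.8), (4.13)] [cite: Teschl2012, §2.4 (Grönwall)]
-/

noncomputable section

-- the sub-problem namespace `NavierStokesRegularity.NavierStokesRegularity` is the tree's layout (D-0017)
set_option linter.dupNamespace false

namespace Summit.NavierStokesRegularity.NavierStokesRegularity.Theorems

open Set Finset MeasureTheory intervalIntegral
open scoped Topology
open Literature.Analysis.FluidPDE.TaoCascade

section PairExit

variable {α : Fin 4 → Fin 4 → Fin 4 → ℤ × ℤ × ℤ → ℝ} {c P : Fin 4 → ℝ}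
  (hs : IsSymmetricCoeff α) (hc : IsCancellingCoeff α)
  (hO : ∀ (Y : Fin 4 → ℤ → ℝ → ℝ) (τ : ℝ), (∀ (j : Fin 4) (k : ℤ), 1 ≤ k → 0 ≤ Y j k τ) →
    ∀ δ : ℝ, 0 < δ → ∀ (i : Fin 4) (n : ℤ), 1 ≤ n → Y i n τ = 0 → 0 ≤ quadTerm δ α Y i n τ)
  (hD : ∀ a b i : Fin 4, a ≠ b → α a b i (0, 0, 1) = 0)
  (hF : ∀ a i : Fin 4, α a a i (0, 0, 1) = if (a = 0 ∧ i = 1) ∨ (a = 1 ∧ i = 0) then c a else 0)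
  (hP : ∀ a d : Fin 4, a ≠ d → α a a d (0, 0, 0) = if (a = 0 ∧ d = 2) ∨ (a = 1 ∧ d = 3) then P a else 0)
  (hCz : ∀ a b d : Fin 4, a ≠ b → a ≠ d → b ≠ d → α a b d (0, 0, 0) = 0)
include hs hc hO hD hF hP hCz

omit hO hD hF in
/-- The in-shell coefficient table of the pair-exit class: pumps `P 0` at `(0,0,2)`, `P 1` at `(1,1,3)`, back-reactions `−P/2`. [this file] -/
theorem pairExit_coeff (a b i : Fin 4) :
    α a b i (0, 0, 0) = (if (a = 0 ∧ b = 0 ∧ i = 2) then P 0 else 0) + (if (a = 1 ∧ b = 1 ∧ i = 3) then P 1 else 0) +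
      (if (a = 0 ∧ b = 2 ∧ i = 0) ∨ (a = 2 ∧ b = 0 ∧ i = 0) then -(P 0) / 2 else 0) +
      (if (a = 1 ∧ b = 3 ∧ i = 1) ∨ (a = 3 ∧ b = 1 ∧ i = 1) then -(P 1) / 2 else 0) := by
  have hdiag : ∀ e : Fin 4, α e e e (0, 0, 0) = 0 := fun e => kpProper_inShell_diag_zero hc e
  have hback : ∀ e j : Fin 4, e ≠ j → α e j e (0, 0, 0) = -(α e e j (0, 0, 0)) / 2 := by
    intro e j hej
    have h1 := kpProper_inShell_back hc e j
    have h2 : α j e e (0, 0, 0) = α e j e (0, 0, 0) := hs j e e 0 0 0 kpProper_mem000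
    linarith
  have hback' : ∀ e j : Fin 4, e ≠ j → α j e e (0, 0, 0) = -(α e e j (0, 0, 0)) / 2 := by
    intro e j hej
    rw [hs j e e 0 0 0 kpProper_mem000, hback e j hej]
  fin_cases a <;> fin_cases b <;> fin_cases i <;>
    first
      | (rw [hdiag]; simp)
      | (rw [hCz _ _ _ (by decide) (by decide) (by decide)]; simp)
      | (rw [hP _ _ (by decide)]; simp)
      | (rw [hback _ _ (by decide), hP _ _ (by decide)]; simp)
      | (rw [hback' _ _ (by decide), hP _ _ (by decide)]; simp)

omit hO hD hF in
/-- The in-shell quadratic forms of the four components. [this file] -/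
theorem pairExit_inShell (y : Fin 4 → ℝ) (i : Fin 4) :
    ∑ a, ∑ b, α a b i (0, 0, 0) * (y a * y b) =
      (if i = 0 then -(P 0 * (y 0 * y 2)) else 0) + (if i = 1 then -(P 1 * (y 1 * y 3)) else 0) +
        (if i = 2 then P 0 * (y 0 * y 0) else 0) + (if i = 3 then P 1 * (y 1 * y 1) else 0) := by
  simp only [pairExit_coeff hs hc hP hCz, Fin.sum_univ_four]
  fin_cases i
  · simp
    ring
  · simp
    ring
  · simp
  · simp

omit hs hc hO hD hP hCz in
/-- The feed sums of the class. [this file] -/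
theorem pairExit_feedSum (y : Fin 4 → ℝ) (i : Fin 4) :
    ∑ a, α a a i (0, 0, 1) * y a ^ 2 = (if i = 1 then c 0 * y 0 ^ 2 else 0) + (if i = 0 then c 1 * y 1 ^ 2 else 0) := by
  simp only [hF, Fin.sum_univ_four]
  fin_cases i <;> simp

omit hs hc hO hD hP hCz in
/-- The drain sums of the class. [this file] -/
theorem pairExit_drainSum (z : Fin 4 → ℝ) (i : Fin 4) :
    ∑ j, α i i j (0, 0, 1) * z j = (if i = 0 then c 0 * z 1 else 0) + (if i = 1 then c 1 * z 0 else 0) := by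
  simp only [hF, Fin.sum_univ_four]
  fin_cases i <;> simp

omit hs hc hO hD hP hCz in
/-- The gate flux through the bond `m → m+1`: `Λ_m (c₀ x²_{0,m} x_{1,m+1} + c₁ x²_{1,m} x_{0,m+1})`. [this file] -/
theorem pairExit_gateFlux (ε₀ : ℝ) (X : Fin 4 → ℤ → ℝ → ℝ) (m : ℕ) (τ : ℝ) :
    (1 + ε₀) ^ ((5 : ℝ) * (m : ℝ) / 2) * ∑ i, ∑ j, α i i j (0, 0, 1) * X i (m : ℤ) τ ^ 2 * X j ((m : ℤ) + 1) τ =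
      (1 + ε₀) ^ ((5 : ℝ) * (m : ℝ) / 2) *
        (c 0 * X 0 (m : ℤ) τ ^ 2 * X 1 ((m : ℤ) + 1) τ + c 1 * X 1 (m : ℤ) τ ^ 2 * X 0 ((m : ℤ) + 1) τ) := by
  congr 1
  simp only [hF, Fin.sum_univ_four]
  simp

/-- **Mode 0**: `quadTerm₀(n) = c₁Λ_{n-1}x²_{1,n-1} − Λₙ x_{0,n}(c₀ x_{1,n+1} + P₀ x_{2,n})`. [this file] -/
theorem pairExit_quadTerm_zero (ε₀ : ℝ) (X : Fin 4 → ℤ → ℝ → ℝ) (n : ℤ) (t : ℝ) :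
    quadTerm ε₀ α X 0 n t = c 1 * (1 + ε₀) ^ ((5 : ℝ) * ((n : ℝ) - 1) / 2) * X 1 (n - 1) t ^ 2 -
      (1 + ε₀) ^ ((5 : ℝ) * n / 2) * (X 0 n t * (c 0 * X 1 (n + 1) t + P 0 * X 2 n t)) := by
  rw [kpProper_quadTerm hs hc hO hD, pairExit_feedSum hF (fun a => X a (n - 1) t) 0,
    pairExit_drainSum hF (fun j => X j (n + 1) t) 0, pairExit_inShell hs hc hP hCz (fun j => X j n t) 0]
  simp
  ring

/-- **Mode 1**: `quadTerm₁(n) = c₀Λ_{n-1}x²_{0,n-1} − Λₙ x_{1,n}(c₁ x_{0,n+1} + P₁ x_{3,n})`. [this file] -/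
theorem pairExit_quadTerm_one (ε₀ : ℝ) (X : Fin 4 → ℤ → ℝ → ℝ) (n : ℤ) (t : ℝ) :
    quadTerm ε₀ α X 1 n t = c 0 * (1 + ε₀) ^ ((5 : ℝ) * ((n : ℝ) - 1) / 2) * X 0 (n - 1) t ^ 2 -
      (1 + ε₀) ^ ((5 : ℝ) * n / 2) * (X 1 n t * (c 1 * X 0 (n + 1) t + P 1 * X 3 n t)) := by
  rw [kpProper_quadTerm hs hc hO hD, pairExit_feedSum hF (fun a => X a (n - 1) t) 1,
    pairExit_drainSum hF (fun j => X j (n + 1) t) 1, pairExit_inShell hs hc hP hCz (fun j => X j n t) 1]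
  simp
  ring

/-- **Pocket 2** (dead end of mode 0): `quadTerm₂(n) = P₀Λₙ x²_{0,n}`. [this file] -/
theorem pairExit_quadTerm_two (ε₀ : ℝ) (X : Fin 4 → ℤ → ℝ → ℝ) (n : ℤ) (t : ℝ) :
    quadTerm ε₀ α X 2 n t = P 0 * (1 + ε₀) ^ ((5 : ℝ) * n / 2) * (X 0 n t * X 0 n t) := by
  rw [kpProper_quadTerm hs hc hO hD, pairExit_feedSum hF (fun a => X a (n - 1) t) 2,
    pairExit_drainSum hF (fun j => X j (n + 1) t) 2, pairExit_inShell hs hc hP hCz (fun j => X j n t) 2]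
  simp
  ring

/-- **Pocket 3** (dead end of mode 1): `quadTerm₃(n) = P₁Λₙ x²_{1,n}`. [this file] -/
theorem pairExit_quadTerm_three (ε₀ : ℝ) (X : Fin 4 → ℤ → ℝ → ℝ) (n : ℤ) (t : ℝ) :
    quadTerm ε₀ α X 3 n t = P 1 * (1 + ε₀) ^ ((5 : ℝ) * n / 2) * (X 1 n t * X 1 n t) := by
  rw [kpProper_quadTerm hs hc hO hD, pairExit_feedSum hF (fun a => X a (n - 1) t) 3,
    pairExit_drainSum hF (fun j => X j (n + 1) t) 3, pairExit_inShell hs hc hP hCz (fun j => X j n t) 3]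
  simp
  ring

/-- **The pocket of mode `0` dominates the next amplitude of mode `1`**: along an honest non-negative `ν`-viscous solution from a one-shell datum (`c > 0`, `P ≥ 0`, `ε₀ ≥ 0`), for every shell `N ≥ 1` and `t ∈ [0,s]`: `(P 0/c 0)·x_{1,N+1}(t) ≤ x_{2,N}(t)` (both are driven by `Λ_N x²_{0,N}` with weights `P 0`, `c 0`; one-sided Grönwall). [cite: Teschl2012, §2.4 (Grönwall)] -/
theorem pairExit_pocket_ge_zero {ε₀ ν s : ℝ} (hε : 0 ≤ ε₀) (hν : 0 ≤ ν) (hcpos : ∀ i, 0 < c i) (hPnn : ∀ i, 0 ≤ P i)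
    {X₀ : Fin 4 → ℝ} {X : Fin 4 → ℤ → ℝ → ℝ}
    (hdat : ∀ (i : Fin 4) (k : ℤ), X i k 0 = if k = 0 then X₀ i else 0)
    (hode : ∀ (i : Fin 4) (k : ℤ), ∀ t ∈ Icc (0 : ℝ) s, HasDerivWithinAt (X i k)
      (quadTerm ε₀ α X i k t - ν * (1 + ε₀) ^ ((2 : ℝ) * k) * X i k t) (Icc (0 : ℝ) s) t)
    (hnn : ∀ t ∈ Icc (0 : ℝ) s, ∀ (i : Fin 4) (k : ℤ), 1 ≤ k → 0 ≤ X i k t)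
    {N : ℤ} (hN : 1 ≤ N) : ∀ t ∈ Icc (0 : ℝ) s, P 0 / c 0 * X 1 (N + 1) t ≤ X 2 N t := by
  set κ : ℝ := ν * (1 + ε₀) ^ ((2 : ℝ) * N) with hκ
  set κ' : ℝ := ν * (1 + ε₀) ^ ((2 : ℝ) * ((N + 1 : ℤ) : ℝ)) with hκ'
  have hb1 : (1 : ℝ) ≤ 1 + ε₀ := by linarith
  have hκκ' : κ ≤ κ' := by
    simp only [hκ, hκ']
    refine mul_le_mul_of_nonneg_left (Real.rpow_le_rpow_of_exponent_le hb1 ?_) hν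
    push_cast
    linarith
  have hc0 : 0 < c 0 := hcpos 0
  set u : ℝ → ℝ := fun τ => X 2 N τ - P 0 / c 0 * X 1 (N + 1) τ with hu
  set u' : ℝ → ℝ := fun τ =>
    (P 0 * (1 + ε₀) ^ ((5 : ℝ) * N / 2) * (X 0 N τ * X 0 N τ) - κ * X 2 N τ) -
      P 0 / c 0 * (c 0 * (1 + ε₀) ^ ((5 : ℝ) * ((((N + 1 : ℤ)) : ℝ) - 1) / 2) * X 0 (N + 1 - 1) τ ^ 2 -
        (1 + ε₀) ^ ((5 : ℝ) * ((N + 1 : ℤ) : ℝ) / 2) *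
          (X 1 (N + 1) τ * (c 1 * X 0 (N + 1 + 1) τ + P 1 * X 3 (N + 1) τ)) -
        κ' * X 1 (N + 1) τ) with hu'
  have hud : ∀ τ ∈ Icc (0 : ℝ) s, HasDerivWithinAt u (u' τ) (Icc 0 s) τ := by
    intro τ hτ
    have h1 := hode 2 N τ hτ
    rw [pairExit_quadTerm_two hs hc hO hD hF hP hCz] at h1
    have h0 := hode 1 (N + 1) τ hτ
    rw [pairExit_quadTerm_one hs hc hO hD hF hP hCz] at h0
    exact h1.sub (h0.const_mul (P 0 / c 0))
  have hkey : ∀ τ ∈ Icc (0 : ℝ) s, 0 ≤ u' τ + κ * u τ := by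
    intro τ hτ
    have hx1 : 0 ≤ X 1 (N + 1) τ := hnn τ hτ 1 _ (by omega)
    have hx2 : 0 ≤ X 0 (N + 1 + 1) τ := hnn τ hτ 0 _ (by omega)
    have hy1 : 0 ≤ X 3 (N + 1) τ := hnn τ hτ 3 _ (by omega)
    have hΛ : 0 ≤ (1 + ε₀) ^ ((5 : ℝ) * ((N + 1 : ℤ) : ℝ) / 2) := Real.rpow_nonneg (by linarith) _
    have hsimp : u' τ + κ * u τ =
        P 0 / c 0 * ((1 + ε₀) ^ ((5 : ℝ) * ((N + 1 : ℤ) : ℝ) / 2) *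
          (X 1 (N + 1) τ * (c 1 * X 0 (N + 1 + 1) τ + P 1 * X 3 (N + 1) τ))) +
          P 0 / c 0 * (κ' - κ) * X 1 (N + 1) τ := by
      have hidx : (N + 1 - 1 : ℤ) = N := by omega
      have hexp : ((5 : ℝ) * ((((N + 1 : ℤ)) : ℝ) - 1) / 2) = (5 : ℝ) * N / 2 := by push_cast; ring
      simp only [hu, hu', hidx, hexp]
      field_simp
      ring
    rw [hsimp]
    have hPc : 0 ≤ P 0 / c 0 := div_nonneg (hPnn 0) hc0.le
    have hA : 0 ≤ (1 + ε₀) ^ ((5 : ℝ) * ((N + 1 : ℤ) : ℝ) / 2) *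
        (X 1 (N + 1) τ * (c 1 * X 0 (N + 1 + 1) τ + P 1 * X 3 (N + 1) τ)) :=
      mul_nonneg hΛ (mul_nonneg hx1 (add_nonneg (mul_nonneg (hcpos 1).le hx2) (mul_nonneg (hPnn 1) hy1)))
    have hB : 0 ≤ P 0 / c 0 * (κ' - κ) * X 1 (N + 1) τ :=
      mul_nonneg (mul_nonneg hPc (by linarith)) hx1
    exact add_nonneg (mul_nonneg hPc hA) hB
  set G : ℝ → ℝ := fun τ => Real.exp (κ * τ) * u τ with hG
  set G' : ℝ → ℝ := fun τ => Real.exp (κ * τ) * (u' τ + κ * u τ) with hG'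
  have hGd : ∀ τ ∈ Icc (0 : ℝ) s, HasDerivWithinAt G (G' τ) (Icc 0 s) τ := by
    intro τ hτ
    have he : HasDerivWithinAt (fun θ => Real.exp (κ * θ)) (Real.exp (κ * τ) * κ) (Icc 0 s) τ := by
      have := ((hasDerivAt_id τ).const_mul κ).exp
      simpa using this.hasDerivWithinAt
    have h := he.mul (hud τ hτ)
    refine h.congr_deriv ?_
    simp only [hG']
    ring
  have hGmono : MonotoneOn G (Icc 0 s) := by
    have hGcont : ContinuousOn G (Icc 0 s) := fun τ hτ => (hGd τ hτ).continuousWithinAt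
    refine monotoneOn_of_hasDerivWithinAt_nonneg (f' := G') (convex_Icc 0 s) hGcont ?_ ?_
    · intro x hx
      rw [interior_Icc] at hx ⊢
      exact (hGd x (Ioo_subset_Icc_self hx)).mono Ioo_subset_Icc_self
    · intro x hx
      rw [interior_Icc] at hx
      exact mul_nonneg (Real.exp_pos _).le (hkey x (Ioo_subset_Icc_self hx))
  have hG0 : G 0 = 0 := by
    have h1 : X 2 N 0 = 0 := by rw [hdat]; simp; omega
    have h2 : X 1 (N + 1) 0 = 0 := by rw [hdat]; simp; omega
    simp [hG, hu, h1, h2]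
  intro t ht
  have hGt : 0 ≤ G t := by
    rw [← hG0]
    exact hGmono ⟨le_rfl, ht.1.trans ht.2⟩ ht ht.1
  have hexp : 0 < Real.exp (κ * t) := Real.exp_pos _
  have hut : 0 ≤ u t := by
    by_contra hh
    push Not at hh
    have : G t < 0 := by simp only [hG]; nlinarith [mul_pos hexp (neg_pos.2 hh)]
    linarith
  simp only [hu] at hut
  linarith

/-- **The pocket of mode `1` dominates the next amplitude of mode `0`**: for every shell `N ≥ 1` and `t ∈ [0,s]`: `(P 1/c 1)·x_{0,N+1}(t) ≤ x_{3,N}(t)`. [cite: Teschl2012, §2.4 (Grönwall)] -/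
theorem pairExit_pocket_ge_one {ε₀ ν s : ℝ} (hε : 0 ≤ ε₀) (hν : 0 ≤ ν) (hcpos : ∀ i, 0 < c i) (hPnn : ∀ i, 0 ≤ P i)
    {X₀ : Fin 4 → ℝ} {X : Fin 4 → ℤ → ℝ → ℝ}
    (hdat : ∀ (i : Fin 4) (k : ℤ), X i k 0 = if k = 0 then X₀ i else 0)
    (hode : ∀ (i : Fin 4) (k : ℤ), ∀ t ∈ Icc (0 : ℝ) s, HasDerivWithinAt (X i k)
      (quadTerm ε₀ α X i k t - ν * (1 + ε₀) ^ ((2 : ℝ) * k) * X i k t) (Icc (0 : ℝ) s) t)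
    (hnn : ∀ t ∈ Icc (0 : ℝ) s, ∀ (i : Fin 4) (k : ℤ), 1 ≤ k → 0 ≤ X i k t)
    {N : ℤ} (hN : 1 ≤ N) : ∀ t ∈ Icc (0 : ℝ) s, P 1 / c 1 * X 0 (N + 1) t ≤ X 3 N t := by
  set κ : ℝ := ν * (1 + ε₀) ^ ((2 : ℝ) * N) with hκ
  set κ' : ℝ := ν * (1 + ε₀) ^ ((2 : ℝ) * ((N + 1 : ℤ) : ℝ)) with hκ'
  have hb1 : (1 : ℝ) ≤ 1 + ε₀ := by linarith
  have hκκ' : κ ≤ κ' := by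
    simp only [hκ, hκ']
    refine mul_le_mul_of_nonneg_left (Real.rpow_le_rpow_of_exponent_le hb1 ?_) hν
    push_cast
    linarith
  have hc0 : 0 < c 1 := hcpos 1
  set u : ℝ → ℝ := fun τ => X 3 N τ - P 1 / c 1 * X 0 (N + 1) τ with hu
  set u' : ℝ → ℝ := fun τ =>
    (P 1 * (1 + ε₀) ^ ((5 : ℝ) * N / 2) * (X 1 N τ * X 1 N τ) - κ * X 3 N τ) -
      P 1 / c 1 * (c 1 * (1 + ε₀) ^ ((5 : ℝ) * ((((N + 1 : ℤ)) : ℝ) - 1) / 2) * X 1 (N + 1 - 1) τ ^ 2 -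
        (1 + ε₀) ^ ((5 : ℝ) * ((N + 1 : ℤ) : ℝ) / 2) *
          (X 0 (N + 1) τ * (c 0 * X 1 (N + 1 + 1) τ + P 0 * X 2 (N + 1) τ)) -
        κ' * X 0 (N + 1) τ) with hu'
  have hud : ∀ τ ∈ Icc (0 : ℝ) s, HasDerivWithinAt u (u' τ) (Icc 0 s) τ := by
    intro τ hτ
    have h1 := hode 3 N τ hτ
    rw [pairExit_quadTerm_three hs hc hO hD hF hP hCz] at h1
    have h0 := hode 0 (N + 1) τ hτ
    rw [pairExit_quadTerm_zero hs hc hO hD hF hP hCz] at h0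
    exact h1.sub (h0.const_mul (P 1 / c 1))
  have hkey : ∀ τ ∈ Icc (0 : ℝ) s, 0 ≤ u' τ + κ * u τ := by
    intro τ hτ
    have hx1 : 0 ≤ X 0 (N + 1) τ := hnn τ hτ 0 _ (by omega)
    have hx2 : 0 ≤ X 1 (N + 1 + 1) τ := hnn τ hτ 1 _ (by omega)
    have hy1 : 0 ≤ X 2 (N + 1) τ := hnn τ hτ 2 _ (by omega)
    have hΛ : 0 ≤ (1 + ε₀) ^ ((5 : ℝ) * ((N + 1 : ℤ) : ℝ) / 2) := Real.rpow_nonneg (by linarith) _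
    have hsimp : u' τ + κ * u τ =
        P 1 / c 1 * ((1 + ε₀) ^ ((5 : ℝ) * ((N + 1 : ℤ) : ℝ) / 2) *
          (X 0 (N + 1) τ * (c 0 * X 1 (N + 1 + 1) τ + P 0 * X 2 (N + 1) τ))) +
          P 1 / c 1 * (κ' - κ) * X 0 (N + 1) τ := by
      have hidx : (N + 1 - 1 : ℤ) = N := by omega
      have hexp : ((5 : ℝ) * ((((N + 1 : ℤ)) : ℝ) - 1) / 2) = (5 : ℝ) * N / 2 := by push_cast; ring
      simp only [hu, hu', hidx, hexp]
      field_simp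
      ring
    rw [hsimp]
    have hPc : 0 ≤ P 1 / c 1 := div_nonneg (hPnn 1) hc0.le
    have hA : 0 ≤ (1 + ε₀) ^ ((5 : ℝ) * ((N + 1 : ℤ) : ℝ) / 2) *
        (X 0 (N + 1) τ * (c 0 * X 1 (N + 1 + 1) τ + P 0 * X 2 (N + 1) τ)) :=
      mul_nonneg hΛ (mul_nonneg hx1 (add_nonneg (mul_nonneg (hcpos 0).le hx2) (mul_nonneg (hPnn 0) hy1)))
    have hB : 0 ≤ P 1 / c 1 * (κ' - κ) * X 0 (N + 1) τ :=
      mul_nonneg (mul_nonneg hPc (by linarith)) hx1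
    exact add_nonneg (mul_nonneg hPc hA) hB
  set G : ℝ → ℝ := fun τ => Real.exp (κ * τ) * u τ with hG
  set G' : ℝ → ℝ := fun τ => Real.exp (κ * τ) * (u' τ + κ * u τ) with hG'
  have hGd : ∀ τ ∈ Icc (0 : ℝ) s, HasDerivWithinAt G (G' τ) (Icc 0 s) τ := by
    intro τ hτ
    have he : HasDerivWithinAt (fun θ => Real.exp (κ * θ)) (Real.exp (κ * τ) * κ) (Icc 0 s) τ := by
      have := ((hasDerivAt_id τ).const_mul κ).exp
      simpa using this.hasDerivWithinAt
    have h := he.mul (hud τ hτ)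
    refine h.congr_deriv ?_
    simp only [hG']
    ring
  have hGmono : MonotoneOn G (Icc 0 s) := by
    have hGcont : ContinuousOn G (Icc 0 s) := fun τ hτ => (hGd τ hτ).continuousWithinAt
    refine monotoneOn_of_hasDerivWithinAt_nonneg (f' := G') (convex_Icc 0 s) hGcont ?_ ?_
    · intro x hx
      rw [interior_Icc] at hx ⊢
      exact (hGd x (Ioo_subset_Icc_self hx)).mono Ioo_subset_Icc_self
    · intro x hx
      rw [interior_Icc] at hx
      exact mul_nonneg (Real.exp_pos _).le (hkey x (Ioo_subset_Icc_self hx))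
  have hG0 : G 0 = 0 := by
    have h1 : X 3 N 0 = 0 := by rw [hdat]; simp; omega
    have h2 : X 0 (N + 1) 0 = 0 := by rw [hdat]; simp; omega
    simp [hG, hu, h1, h2]
  intro t ht
  have hGt : 0 ≤ G t := by
    rw [← hG0]
    exact hGmono ⟨le_rfl, ht.1.trans ht.2⟩ ht ht.1
  have hexp : 0 < Real.exp (κ * t) := Real.exp_pos _
  have hut : 0 ≤ u t := by
    by_contra hh
    push Not at hh
    have : G t < 0 := by simp only [hG]; nlinarith [mul_pos hexp (neg_pos.2 hh)]
    linarith
  simp only [hu] at hut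
  linarith

end PairExit

end Summit.NavierStokesRegularity.NavierStokesRegularity.Theorems

end
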